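import Summits.RiemannHypothesis.RiemannHypothesis.Theorems.PfPersistenceDilatingLandauWeightedMellin
import Literature.NumberTheory.LFunctions.NicolasJ
import Mathlib.MeasureTheory.Integral.IntervalIntegral.IntegrationByParts
import HarnessLib

/-!
# LANDAU for the weighted dilating statistic `S(x) = Σ_{n ≤ x} Λ(n)/√n` — IV: Abel summation and the `ψ₁` transfer

Cell `pub-rhpf` (mechanism/rigidity campaign; **no RH claims**), CAND SEAT 7 gen 8, CASE-DAG v6 §6
kernel target LANDAU, weighted statistic `S`. This file is the RH-free calculus that ties
`S(x) − 2√x` to `ψ(x) − x` and to `ψ₁(x) − x²/2`: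

* §6 `wpsi_eq_abel`: `S(x) = x^{-1/2} ψ(x) + ½ ∫_{(1,x]} t^{-3/2} ψ(t) dt` (Abel summation);
* §8 `wpsiErr_eq_psi_add`: `S(x) − 2√x = x^{-1/2}(ψ(x) − x) + ½ J(x) − 1` with
  `J(x) = ∫_{(1,x]} t^{-3/2}(ψ(t) − t) dt` (`psiRemInt`), and the integration by parts
  `psiRemInt_eq_parts`: `J(x) = x^{-3/2} D(x) + ½ + (3/2) ∫_{(1,x]} t^{-5/2} D(t) dt`,
  `D(t) = ψ₁(t) − t²/2` (`psiOneErr`; `ψ₁' = ψ` from the right, tree `NicolasJ.hasDerivWithinAt_psiOne`);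
* `psiOneErr_eq_re`: the explicit formula for `ψ₁` (tree `psiOne_eq_explicit`, MV (13.7)) read as
  `D(t) = −Re Σ_ρ m(ρ) t^{ρ+1}/(ρ(ρ+1)) − t log 2π + Re E(t)`, and under RH
  `|D(t)| ≤ K t^{3/2}` (`exists_abs_psiOneErr_le_of_riemannHypothesis`, MV (13.8)).

The point (completed in `PfPersistenceDilatingLandauWeightedZeroSum`): under RH the `t^{-5/2} D(t)`
integral is BOUNDED (the zero sum integrates to `Σ_ρ m x^{iγ}/(ρ(ρ+1)iγ) = O(1)`), so
`S(x) − 2√x = (ψ(x) − x)/√x + O(1)` and Littlewood's `Ω±(√x log log log x)` for `ψ` transfers to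
`S(x) − 2√x = Ω±(log log log x)`: the `O(1)` one-sided readers of `S` are unsound under RH as well as
off RH. RH-free here except where `RiemannHypothesis` is an explicit hypothesis; sorry-free.

References: [MontgomeryVaughan2007] H. L. Montgomery, R. C. Vaughan, *Multiplicative Number Theory I*,
CUP 2007, §13.1 ((13.7)–(13.8), Thm. 13.1), §15.1.
-/

noncomputable section

-- the sub-problem path RiemannHypothesis/RiemannHypothesis duplicates a namespace (D-0017)
set_option linter.dupNamespace false

open Filter Topology Set MeasureTheory

namespace Summit.RiemannHypothesis.RiemannHypothesis.Theorems.PfPersistenceDilatingLandauWeightedAbel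

open Literature.NumberTheory.LFunctions
open Summit.RiemannHypothesis.RiemannHypothesis.Theorems.PfPersistenceDilatingLandauWeightedMellin

/-! ## §6 Abel summation for `S` -/

/-- **Abel summation:** `S(x) = x^{-1/2} ψ(x) + ½ ∫_{(1,x]} t^{-3/2} ψ(t) dt` (both sides vanish
for `x < 1`). [cite: MontgomeryVaughan2007, Thm. 13.1 (partial summation); folklore] -/
theorem wpsi_eq_abel (x : ℝ) :
    wpsi x = x ^ (-(1 / 2 : ℝ)) * Chebyshev.psi x +
      1 / 2 * ∫ t in Ioc 1 x, t ^ (-(3 / 2 : ℝ)) * Chebyshev.psi t := by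
  set c : ℕ → ℝ := fun k ↦ (ArithmeticFunction.vonMangoldt k : ℝ) with hc
  set f : ℝ → ℝ := fun t ↦ t ^ (-(1 / 2 : ℝ)) with hf
  have hD : ∀ t : ℝ, 0 < t → HasDerivAt f (-(1 / 2) * t ^ (-(3 / 2 : ℝ))) t := by
    intro t ht
    have h := Real.hasDerivAt_rpow_const (x := t) (p := -(1 / 2 : ℝ)) (Or.inl ht.ne')
    rw [show (-(1 / 2 : ℝ)) - 1 = -(3 / 2 : ℝ) by norm_num] at h
    exact h
  have hf_diff : ∀ t ∈ Set.Icc 1 x, DifferentiableAt ℝ f t := fun t ht ↦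
    (hD t (by linarith [ht.1])).differentiableAt
  have hderiv_eq : Set.EqOn (deriv f) (fun t ↦ -(1 / 2) * t ^ (-(3 / 2 : ℝ))) (Set.Icc 1 x) :=
    fun t ht ↦ (hD t (by linarith [ht.1])).deriv
  have hcont : ContinuousOn (fun t : ℝ ↦ -(1 / 2) * t ^ (-(3 / 2 : ℝ))) (Set.Icc 1 x) :=
    continuousOn_const.mul
      (ContinuousOn.rpow_const (by fun_prop) fun t ht ↦ Or.inl (by linarith [ht.1] : t ≠ 0))
  have hf_int : IntegrableOn (deriv f) (Set.Icc 1 x) :=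
    hcont.integrableOn_Icc.congr_fun hderiv_eq.symm measurableSet_Icc
  have hc0 : c 0 = 0 := by simp [hc]
  have habel := sum_mul_eq_sub_integral_mul₀ c hc0 x hf_diff hf_int
  have hIcc : Finset.Icc 1 ⌊x⌋₊ = Finset.Ioc 0 ⌊x⌋₊ := by
    ext n
    simp only [Finset.mem_Icc, Finset.mem_Ioc]
    omega
  have hL : ∑ k ∈ Finset.Icc 0 ⌊x⌋₊, f k * c k = wpsi x := by
    rw [Finset.Icc_eq_cons_Ioc (Nat.zero_le _), Finset.sum_cons, hc0, mul_zero, zero_add]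
    unfold wpsi wpsiNat
    rw [hIcc]
    refine Finset.sum_congr rfl fun k _ ↦ ?_
    simp only [hf, hc, wcoef]
    rw [Real.rpow_neg (Nat.cast_nonneg k), inv_mul_eq_div]
  have hψ : ∀ t : ℝ, ∑ k ∈ Finset.Icc 0 ⌊t⌋₊, c k = Chebyshev.psi t := fun t ↦ by
    rw [Chebyshev.psi_eq_sum_Icc]
  rw [← hL, habel, hψ x]
  have hI : ∫ t in Set.Ioc 1 x, deriv f t * ∑ k ∈ Finset.Icc 0 ⌊t⌋₊, c k =
      ∫ t in Set.Ioc 1 x, -(1 / 2) * (t ^ (-(3 / 2 : ℝ)) * Chebyshev.psi t) := by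
    refine setIntegral_congr_fun measurableSet_Ioc fun t ht ↦ ?_
    rw [hderiv_eq ⟨ht.1.le, ht.2⟩, hψ t]
    ring
  rw [hI, integral_const_mul]
  simp only [hf]
  ring

/-- `t ↦ t^{-3/2} g(t)` is integrable on `(1, x]` for a measurable `g` bounded on `(1, x]`.
[folklore] -/
theorem integrableOn_rpow_mul_of_bdd {g : ℝ → ℝ} (hg : Measurable g) {x M a : ℝ}
    (hM : ∀ t ∈ Ioc 1 x, |g t| ≤ M) :
    IntegrableOn (fun t : ℝ ↦ t ^ a * g t) (Ioc 1 x) := by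
  have hx' : IntegrableOn (fun t : ℝ ↦ t ^ a) (Ioc 1 x) := by
    refine (ContinuousOn.rpow_const (by fun_prop) fun t ht ↦ Or.inl ?_).integrableOn_Icc.mono_set
      Ioc_subset_Icc_self
    linarith [ht.1]
  refine Integrable.mono' (hx'.norm.mul_const M)
    ((measurable_id.pow_const _).mul hg).aestronglyMeasurable ?_
  rw [ae_restrict_iff' measurableSet_Ioc]
  refine Eventually.of_forall fun t ht ↦ ?_
  rw [norm_mul, Real.norm_eq_abs, Real.norm_eq_abs]
  exact mul_le_mul_of_nonneg_left (hM t ht) (abs_nonneg _)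

/-! ## §8 `S − 2√x` against `(ψ − x)/√x`: the remainder integral and `ψ₁` -/

/-- `D(t) = ψ₁(t) − t²/2`, the error in `ψ₁(x) = Σ_{n ≤ x} Λ(n)(x − n) ∼ x²/2`. [cite: MontgomeryVaughan2007, §13.1 (13.8)] -/
def psiOneErr (t : ℝ) : ℝ := psiOne t - t ^ 2 / 2

/-- `J(x) = ∫_{(1,x]} t^{-3/2} (ψ(t) − t) dt`. [folklore] -/
def psiRemInt (x : ℝ) : ℝ := ∫ t in Ioc 1 x, t ^ (-(3 / 2 : ℝ)) * (Chebyshev.psi t - t)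

/-- `ψ₁(1) = 0`. [folklore] -/
theorem psiOne_one : psiOne 1 = 0 := by
  unfold psiOne
  rw [Nat.floor_one, show Finset.Ioc 0 1 = {1} by decide]
  simp

/-- `D(1) = −1/2`. [folklore] -/
theorem psiOneErr_one : psiOneErr 1 = -(1 / 2) := by
  rw [psiOneErr, psiOne_one]; norm_num

/-- `D` is continuous. [folklore] -/
theorem continuous_psiOneErr : Continuous psiOneErr :=
  NicolasJ.continuous_psiOne.sub (by fun_prop)

/-- The right derivative of `D(t) = ψ₁(t) − t²/2` is `ψ(t) − t`. [folklore] -/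
theorem hasDerivWithinAt_psiOneErr (t : ℝ) :
    HasDerivWithinAt psiOneErr (Chebyshev.psi t - t) (Ioi t) t := by
  have h2 : HasDerivAt (fun u : ℝ ↦ u ^ 2 / 2) t t := by
    refine ((hasDerivAt_pow 2 t).div_const 2).congr_deriv ?_
    norm_num
  exact (NicolasJ.hasDerivWithinAt_psiOne t).sub h2.hasDerivWithinAt

/-- **Integration by parts:** for `x ≥ 1`,
`J(x) = x^{-3/2} D(x) + ½ + (3/2) ∫_{(1,x]} t^{-5/2} D(t) dt`. [folklore] -/
theorem psiRemInt_eq_parts {x : ℝ} (hx : 1 ≤ x) :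
    psiRemInt x = x ^ (-(3 / 2 : ℝ)) * psiOneErr x + 1 / 2 +
      3 / 2 * ∫ t in Ioc 1 x, t ^ (-(5 / 2 : ℝ)) * psiOneErr t := by
  have h0 : ∀ t ∈ Set.uIcc 1 x, (0 : ℝ) < t := by
    intro t ht
    rw [Set.uIcc_of_le hx] at ht
    linarith [ht.1]
  have hu : ContinuousOn (fun t : ℝ ↦ t ^ (-(3 / 2 : ℝ))) (Set.uIcc 1 x) :=
    ContinuousOn.rpow_const (by fun_prop) fun t ht ↦ Or.inl (h0 t ht).ne'
  have hv : ContinuousOn psiOneErr (Set.uIcc 1 x) := continuous_psiOneErr.continuousOn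
  have huu' : ∀ t ∈ Ioo (min 1 x) (max 1 x),
      HasDerivWithinAt (fun t : ℝ ↦ t ^ (-(3 / 2 : ℝ))) (-(3 / 2 : ℝ) * t ^ (-(5 / 2 : ℝ)))
        (Ioi t) t := by
    intro t ht
    rw [min_eq_left hx, max_eq_right hx] at ht
    have ht0 : 0 < t := by linarith [ht.1]
    have h := Real.hasDerivAt_rpow_const (x := t) (p := -(3 / 2 : ℝ)) (Or.inl ht0.ne')
    rw [show (-(3 / 2 : ℝ)) - 1 = -(5 / 2 : ℝ) by norm_num] at h
    exact h.hasDerivWithinAt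
  have hvv' : ∀ t ∈ Ioo (min 1 x) (max 1 x),
      HasDerivWithinAt psiOneErr (Chebyshev.psi t - t) (Ioi t) t := fun t _ ↦
    hasDerivWithinAt_psiOneErr t
  have hu' : IntervalIntegrable (fun t : ℝ ↦ -(3 / 2 : ℝ) * t ^ (-(5 / 2 : ℝ))) volume 1 x :=
    (continuousOn_const.mul
      (ContinuousOn.rpow_const (by fun_prop) fun t ht ↦ Or.inl (h0 t ht).ne')).intervalIntegrable
  have hv' : IntervalIntegrable (fun t : ℝ ↦ Chebyshev.psi t - t) volume 1 x :=
    (NicolasJ.intervalIntegrable_psi 1 x).sub (continuous_id.intervalIntegrable 1 x)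
  have hparts := intervalIntegral.integral_mul_deriv_eq_deriv_mul_of_hasDeriv_right hu hv huu'
    hvv' hu' hv'
  rw [psiRemInt, ← intervalIntegral.integral_of_le hx, hparts, Real.one_rpow, psiOneErr_one,
    ← intervalIntegral.integral_of_le hx]
  have hI : ∫ t in (1 : ℝ)..x, -(3 / 2 : ℝ) * t ^ (-(5 / 2 : ℝ)) * psiOneErr t =
      -(3 / 2 : ℝ) * ∫ t in (1 : ℝ)..x, t ^ (-(5 / 2 : ℝ)) * psiOneErr t := by
    rw [← intervalIntegral.integral_const_mul]
    refine intervalIntegral.integral_congr fun t _ ↦ ?_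
    ring
  rw [hI]
  ring

/-- **`S(x) − 2√x = x^{-1/2}(ψ(x) − x) + ½ J(x) − 1`** for `x ≥ 1`. [cite: MontgomeryVaughan2007, Thm. 13.1 (partial summation); folklore] -/
theorem wpsiErr_eq_psi_add {x : ℝ} (hx : 1 ≤ x) :
    wpsiErr x = x ^ (-(1 / 2 : ℝ)) * (Chebyshev.psi x - x) + 1 / 2 * psiRemInt x - 1 := by
  have hx0 : 0 < x := by linarith
  have hψbdd : ∀ t ∈ Ioc 1 x, |Chebyshev.psi t| ≤ Chebyshev.psi x := fun t ht ↦ by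
    rw [abs_of_nonneg (Chebyshev.psi_nonneg t)]; exact Chebyshev.psi_mono ht.2
  have hEbdd : ∀ t ∈ Ioc 1 x, |Chebyshev.psi t - t| ≤ Chebyshev.psi x + x := fun t ht ↦ by
    have hψt : Chebyshev.psi t ≤ Chebyshev.psi x := Chebyshev.psi_mono ht.2
    have hψ0 := Chebyshev.psi_nonneg t
    rw [abs_le]; constructor <;> linarith [ht.1, ht.2]
  have hidbdd : ∀ t ∈ Ioc 1 x, |(fun u : ℝ ↦ u) t| ≤ x := fun t ht ↦ by
    have h1 : (0 : ℝ) < t := by linarith [ht.1]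
    simp only [abs_of_pos h1]
    exact ht.2
  have hIE : IntegrableOn (fun t : ℝ ↦ t ^ (-(3 / 2 : ℝ)) * (Chebyshev.psi t - t)) (Ioc 1 x) :=
    integrableOn_rpow_mul_of_bdd (Nicolas.measurable_psi.sub measurable_id') hEbdd
  have hIid : IntegrableOn (fun t : ℝ ↦ t ^ (-(3 / 2 : ℝ)) * t) (Ioc 1 x) :=
    integrableOn_rpow_mul_of_bdd (g := fun u : ℝ ↦ u) measurable_id' hidbdd
  have hsplit : ∫ t in Ioc 1 x, t ^ (-(3 / 2 : ℝ)) * Chebyshev.psi t =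
      psiRemInt x + ∫ t in Ioc 1 x, t ^ (-(3 / 2 : ℝ)) * t := by
    rw [psiRemInt, ← integral_add hIE hIid]
    refine setIntegral_congr_fun measurableSet_Ioc fun t _ ↦ ?_
    ring
  have h0uIcc : (0 : ℝ) ∉ Set.uIcc 1 x := by
    rw [Set.uIcc_of_le hx]; intro h; linarith [h.1]
  have hmain : ∫ t in Ioc 1 x, t ^ (-(3 / 2 : ℝ)) * t = 2 * x ^ (1 / 2 : ℝ) - 2 := by
    have h1 : ∫ t in Ioc 1 x, t ^ (-(3 / 2 : ℝ)) * t = ∫ t in Ioc 1 x, t ^ (-(1 / 2 : ℝ)) := by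
      refine setIntegral_congr_fun measurableSet_Ioc fun t ht ↦ ?_
      have ht0 : 0 < t := by linarith [ht.1]
      calc t ^ (-(3 / 2 : ℝ)) * t = t ^ (-(3 / 2 : ℝ)) * t ^ (1 : ℝ) := by rw [Real.rpow_one]
        _ = t ^ (-(1 / 2 : ℝ)) := by rw [← Real.rpow_add ht0]; norm_num
    rw [h1, ← intervalIntegral.integral_of_le hx, integral_rpow (Or.inr ⟨by norm_num, h0uIcc⟩)]
    rw [Real.one_rpow]
    norm_num
    ring
  have hxx : x ^ (-(1 / 2 : ℝ)) * x = x ^ (1 / 2 : ℝ) := by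
    calc x ^ (-(1 / 2 : ℝ)) * x = x ^ (-(1 / 2 : ℝ)) * x ^ (1 : ℝ) := by rw [Real.rpow_one]
      _ = x ^ (1 / 2 : ℝ) := by rw [← Real.rpow_add hx0]; norm_num
  rw [wpsiErr, wpsi_eq_abel, hsplit, hmain, mul_sub, hxx]
  ring

/-! ### The explicit formula for `ψ₁`, real part -/

/-- The zero sum `Σ_ρ m(ρ) t^{ρ+1}/(ρ(ρ+1))` of the explicit formula for `ψ₁` (all non-trivial zeros,
with multiplicity; absolutely convergent, tree `summable_norm_psiOne_zeroTerm`). [cite: MontgomeryVaughan2007, §13.1 (13.7)] -/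
def psiOneZeroSum (t : ℝ) : ℂ :=
  ∑' ρ : RHWave0.riemannZetaNontrivialZeros,
    (riemannZetaZeroOrder (ρ : ℂ) : ℂ) * ((t : ℂ) ^ ((ρ : ℂ) + 1) / ((ρ : ℂ) * (ρ + 1)))

/-- `log 2π`, as the complex logarithm of the real number `2π`. [folklore] -/
theorem complex_log_two_pi : Complex.log (2 * Real.pi) = ((Real.log (2 * Real.pi) : ℝ) : ℂ) := by
  rw [show (2 * Real.pi : ℂ) = ((2 * Real.pi : ℝ) : ℂ) by push_cast; ring,
    Complex.ofReal_log (by positivity)]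

/-- **The explicit formula for `ψ₁`, real part:** for `t ≥ 1`,
`D(t) = −Re Σ_ρ m(ρ) t^{ρ+1}/(ρ(ρ+1)) − t log 2π + Re E(t)` (`E = psiOneRemainder`).
[cite: MontgomeryVaughan2007, §13.1 (13.7)] -/
theorem psiOneErr_eq_re {t : ℝ} (ht : 1 ≤ t) :
    psiOneErr t = -(psiOneZeroSum t).re - t * Real.log (2 * Real.pi) + (psiOneRemainder t).re := by
  have h := psiOne_eq_explicit ht
  have h2 : ((psiOneErr t : ℝ) : ℂ) =
      -psiOneZeroSum t - (t : ℂ) * ((Real.log (2 * Real.pi) : ℝ) : ℂ) + psiOneRemainder t := by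
    rw [psiOneErr, Complex.ofReal_sub, h, psiOneZeroSum, complex_log_two_pi]
    push_cast
    ring
  have h3 := congrArg Complex.re h2
  rw [Complex.ofReal_re] at h3
  rw [h3]
  simp only [Complex.sub_re, Complex.add_re, Complex.neg_re, ← Complex.ofReal_mul, Complex.ofReal_re]

/-- `log 2π ≤ 7`. [folklore] -/
theorem log_two_pi_le : Real.log (2 * Real.pi) ≤ 7 := by
  have h := Real.log_le_sub_one_of_pos (show (0 : ℝ) < 2 * Real.pi by positivity)
  linarith [Real.pi_lt_four]

/-- **Under RH, `|D(t)| ≤ K t^{3/2}` for `t ≥ 1`** (MV (13.8): `ψ₁(x) = x²/2 + O(x^{3/2})`).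
[cite: MontgomeryVaughan2007, §13.1 (13.8)] -/
theorem exists_abs_psiOneErr_le_of_riemannHypothesis (hRH : RiemannHypothesis) :
    ∃ K : ℝ, 0 < K ∧ ∀ t : ℝ, 1 ≤ t → |psiOneErr t| ≤ K * t ^ (3 / 2 : ℝ) := by
  obtain ⟨CE, hCE0, hCE⟩ := exists_norm_psiOneRemainder_le
  have hβ : 0 ≤ nicolasBeta := by
    have h1 := norm_psiOne_sub_le_of_RH hRH (le_refl (1 : ℝ))
    have h2 : (0 : ℝ) ≤ nicolasBeta * (1 : ℝ) ^ (3 / 2 : ℝ) := (norm_nonneg _).trans h1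
    simpa using h2
  refine ⟨nicolasBeta + 7 + CE, by positivity, fun t ht ↦ ?_⟩
  have ht0 : 0 < t := by linarith
  have h1 := norm_psiOne_sub_le_of_RH hRH ht
  have h2 := hCE t ht0
  have ht32 : t ≤ t ^ (3 / 2 : ℝ) := by
    calc t = t ^ (1 : ℝ) := (Real.rpow_one t).symm
      _ ≤ t ^ (3 / 2 : ℝ) := Real.rpow_le_rpow_of_exponent_le ht (by norm_num)
  have hsqrt : Real.sqrt t ≤ t ^ (3 / 2 : ℝ) := by
    rw [Real.sqrt_eq_rpow]
    exact Real.rpow_le_rpow_of_exponent_le ht (by norm_num)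
  have hlog : ‖(t : ℂ) * Complex.log (2 * Real.pi)‖ ≤ 7 * t := by
    rw [complex_log_two_pi, ← Complex.ofReal_mul, Complex.norm_real, Real.norm_eq_abs,
      abs_of_nonneg (mul_nonneg ht0.le (Real.log_nonneg (by linarith [Real.pi_gt_three])))]
    nlinarith [log_two_pi_le]
  have hD : ((psiOneErr t : ℝ) : ℂ) = ((psiOne t : ℂ) - (t : ℂ) ^ 2 / 2 +
      t * Complex.log (2 * Real.pi) - psiOneRemainder t) - t * Complex.log (2 * Real.pi) +
        psiOneRemainder t := by
    rw [psiOneErr]; push_cast; ring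
  have hnorm : |psiOneErr t| ≤ nicolasBeta * t ^ (3 / 2 : ℝ) + 7 * t + CE * Real.sqrt t := by
    rw [← Real.norm_eq_abs, ← Complex.norm_real, hD]
    refine (norm_add_le _ _).trans (add_le_add ((norm_sub_le _ _).trans (add_le_add h1 hlog)) h2)
  calc |psiOneErr t| ≤ nicolasBeta * t ^ (3 / 2 : ℝ) + 7 * t + CE * Real.sqrt t := hnorm
    _ ≤ nicolasBeta * t ^ (3 / 2 : ℝ) + 7 * t ^ (3 / 2 : ℝ) + CE * t ^ (3 / 2 : ℝ) := by
        gcongr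
    _ = (nicolasBeta + 7 + CE) * t ^ (3 / 2 : ℝ) := by ring

end Summit.RiemannHypothesis.RiemannHypothesis.Theorems.PfPersistenceDilatingLandauWeightedAbel

end
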